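import Literature.Analysis.FluidPDE.ClassicalL2Stability
import Literature.Analysis.FluidPDE.VorticityFormulationProofs
import Literature.Analysis.FluidPDE.NSFiniteEnergySmoothProofs
import Literature.Analysis.FluidPDE.NSVorticityBKMContinuation
import HarnessLib

/-!
# The Constantin–Fefferman a priori bound: uniform control of the enstrophy under the
# direction-of-vorticity hypothesis

Analysis/FluidPDE proof file (theorems only), the time-dependent half of the discharge of
`Literature.Analysis.FluidPDE.constantin_fefferman` (`NSVorticity.lean`; Constantin–Fefferman,
Indiana Univ. Math. J. 42 (1993), Theorem of §1; Lemarié-Rieusset 2016, Thm. 11.7). For a classical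
unforced Navier–Stokes solution `(u, p)` on `ℝ³ × [0, T)`, `ν > 0`, in the Beale–Kato–Majda class on
every `[0, T'']`, `T'' < T`, whose vorticity direction satisfies Constantin–Fefferman's hypothesis
`√(1 − ⟪ξ(x,t), ξ(y,t)⟫²) ≤ |x − y|/ρ` on `{|ω| > Ω}`, we prove the **uniform `H¹` bound**
`sup_{t < T} (‖u(t)‖²_{L²} + ‖∇u(t)‖²_{L²}) < ∞` (`exists_uniform_H1_bound_of_direction`):

1. **the vorticity energy identity at a fixed time** (`integral_inner_curl_eq_of_vorticity_eq`):
   if `W + (v·∇)ω = (ω·∇)v + νΔω` (`ω = curl v`) then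
   `∫⟪ω, W⟫ = −ν ∫|∇ω|² + ∫⟪ω, (∇v)ω⟫` (Green's identity and the skew-symmetry of the transport
   term, as in the tree's `ClassicalL2Stability`);
2. the **energy class** (Tao 2013, Lemma 8.1, `tao_finite_energy_smooth_energy_bound_holds`):
   `sup_t ‖u(t)‖²₂ ≤ C‖u₀‖²₂`, `ν∫₀^{T''}‖∇u‖²₂ ≤ C‖u₀‖²₂`, uniformly in `T'' < T`;
3. the **enstrophy balance** `‖ω(b)‖²₂ = ‖ω(0)‖²₂ + ∫₀ᵇ 2∫⟪ω, ∂ₜω⟫`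
   (`IsSmoothSpaceTimeOn.l2_balance` for the vorticity, whose time derivative obeys the vorticity
   equation `isVorticitySolutionOn`), the Constantin–Fefferman stretching estimate
   `exists_two_mul_integral_stretching_le` at each time, and **Grönwall's inequality**
   (`lintegral_gronwall_le`) with the integrable coefficient
   `C₁ + C₂‖ω(t)‖²₂ + C₃ sup‖u‖²₂`, all constants being independent of `T''`;
4. the `div`–`curl` estimate `∫|∇u|² ≤ ∫|ω|²`
   (`lintegral_frobeniusNormSq_fderiv_le_lintegral_sq_norm_curl`).

## References

* P. Constantin, C. Fefferman, Indiana Univ. Math. J. 42 (1993), 775–789, Theorem (§1) and its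
  proof (§2). [ConstantinFeffermanIndiana1993]
* P. G. Lemarié-Rieusset, *The Navier–Stokes Problem in the 21st Century* (2016), Thm. 11.7
  (proof, PDF pp. 369–371). [LemarieRieusset2016]
* T. Tao, Anal. PDE 6 (2013) = arXiv:1108.1165, Lemma 8.1. [Tao2011]
-/

noncomputable section

open MeasureTheory Set Function Filter Metric Real InnerProductSpace
open _root_.Topology
open scoped ENNReal NNReal RealInnerProductSpace ContDiff Laplacian

namespace Literature.Analysis.FluidPDE

-- nested operator types (second and third derivatives)
set_option maxSynthPendingDepth 3

/-! ### Derivatives of the curl -/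

/-- `curl v = curlCLM ∘ Dv` as functions. [folklore] -/
theorem curl_eq_curlCLM_comp_fderiv' (v : (EuclideanSpace ℝ (Fin 3)) → (EuclideanSpace ℝ (Fin 3))) : curl v = curlCLM ∘ fderiv ℝ v := rfl

/-- **`‖Dⁿ(curl v)‖ ≤ ‖curlCLM‖ ‖Dⁿ⁺¹v‖`** pointwise. [folklore] -/
theorem norm_iteratedFDeriv_curl_le_opNorm_mul {v : (EuclideanSpace ℝ (Fin 3)) → (EuclideanSpace ℝ (Fin 3))} {N : ℕ∞} (hv : ContDiff ℝ N v) (n : ℕ)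
    (hn : (n : ℕ∞) + 1 ≤ N) (x : (EuclideanSpace ℝ (Fin 3))) :
    ‖iteratedFDeriv ℝ n (curl v) x‖ ≤ ‖curlCLM‖ * ‖iteratedFDeriv ℝ (n + 1) v x‖ := by
  have hD : ContDiff ℝ n (fderiv ℝ v) := hv.fderiv_right (m := n) (by exact_mod_cast hn)
  rw [curl_eq_curlCLM_comp_fderiv', curlCLM.iteratedFDeriv_comp_left hD.contDiffAt (i := n)
    (by exact_mod_cast le_rfl), ← norm_iteratedFDeriv_fderiv]
  exact ContinuousLinearMap.norm_compContinuousMultilinearMap_le _ _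

/-! ### The vorticity energy identity at a fixed time -/

/-- **The vorticity energy identity.** Let `v ∈ C³(ℝ³; ℝ³)` be divergence free and bounded with
`∇v` bounded and `∇v, ∇²v, ∇³v ∈ L²`, let `ω = curl v`, and let `W` be a continuous square
integrable field with `W + (v·∇)ω = (ω·∇)v + νΔω` pointwise (the vorticity equation at a fixed time,
`W = ∂ₜω`). Then `∫⟪ω, W⟫ = −ν ∫|∇ω|²_F + ∫⟪ω, (∇v) ω⟫`: Green's identity `∫⟪ω, Δω⟫ = −∫|∇ω|²`
and the skew-symmetry `∫⟪ω, (v·∇)ω⟫ = 0` (`div v = 0`), the latter through the tree's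
`integral_inner_weakGrad_apply_self_eq_zero`. This is (11.60) of Lemarié-Rieusset 2016 integrated in
space ("`d/dt ‖ω‖²/2 = −ν‖∇⊗ω‖² + ∫ Σ ε_{ij} ωᵢωⱼ`"). [cite: LemarieRieusset2016, §11.6 (11.60) and Thm. 11.7 (proof, PDF p. 369)] -/
theorem integral_inner_curl_eq_of_vorticity_eq {ν : ℝ} {v W : (EuclideanSpace ℝ (Fin 3)) → (EuclideanSpace ℝ (Fin 3))} (hv : ContDiff ℝ 3 v)
    (hdiv : VectorCalculus.IsDivFree v)
    (heq : ∀ x, W x + convect v (curl v) x = convect (curl v) v x + ν • (Δ (curl v)) x)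
    {B : ℝ} (hB : ∀ x, ‖v x‖ ≤ B) {B₁ : ℝ} (hB₁ : ∀ x, ‖fderiv ℝ v x‖ ≤ B₁)
    (h1 : ∫⁻ x, ‖iteratedFDeriv ℝ 1 v x‖ₑ ^ 2 < ⊤) (h2 : ∫⁻ x, ‖iteratedFDeriv ℝ 2 v x‖ₑ ^ 2 < ⊤)
    (h3 : ∫⁻ x, ‖iteratedFDeriv ℝ 3 v x‖ₑ ^ 2 < ⊤) :
    ∫ x, ⟪curl v x, W x⟫ =
      -ν * (∫ x, frobeniusNormSq (fderiv ℝ (curl v) x)) +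
        ∫ x, ⟪curl v x, fderiv ℝ v x (curl v x)⟫ := by
  set e := EuclideanSpace.basisFun (Fin 3) ℝ with he
  have he1 : ∀ i, ‖e i‖ = 1 := fun i => by simp [he]
  have hB0 : 0 ≤ B := (norm_nonneg _).trans (hB 0)
  have hB₁0 : 0 ≤ B₁ := (norm_nonneg _).trans (hB₁ 0)
  -- the vorticity and its regularity
  have hw : ContDiff ℝ 2 (curl v) := contDiff_curl (n := 2) (by exact hv)
  have hw1 : ContDiff ℝ 1 (curl v) := hw.of_le (by norm_num)
  have hv1 : ContDiff ℝ 1 v := hv.of_le (by norm_num)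
  have cv : Continuous v := hv.continuous
  have cw : Continuous (curl v) := hw.continuous
  have cDv : Continuous (fderiv ℝ v) := hv.continuous_fderiv (by norm_num)
  have cDw : Continuous (fderiv ℝ (curl v)) := hw.continuous_fderiv (by norm_num)
  have cD2w : Continuous fun x => iteratedFDeriv ℝ 2 (curl v) x := hw.continuous_iteratedFDeriv le_rfl
  have hΔ1 : ContDiff ℝ 0 (Δ (curl v)) := contDiff_laplacian (n := 0) (by exact hw)
  have cΔ : Continuous (Δ (curl v)) := hΔ1.continuous
  have cdiw : ∀ i, Continuous fun x => fderiv ℝ (curl v) x (e i) := fun i => cDw.clm_apply continuous_const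
  have cddw : ∀ i, Continuous fun x => fderiv ℝ (fun y => fderiv ℝ (curl v) y (e i)) x (e i) := fun i =>
    ((((hw.fderiv_right (m := 1) (by norm_num)).clm_apply contDiff_const).continuous_fderiv
      (by norm_num)).clm_apply continuous_const)
  -- pointwise norm bounds for the derivatives of `(curl v)`
  have n_w : ∀ x, ‖(curl v) x‖ ≤ ‖(‖curlCLM‖ : ℝ) • iteratedFDeriv ℝ 1 v x‖ := fun x => by
    rw [norm_smul, Real.norm_of_nonneg (norm_nonneg _)]
    have h := norm_iteratedFDeriv_curl_le_opNorm_mul hv 0 (by norm_num) x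
    rwa [norm_iteratedFDeriv_zero] at h
  have n_Dw : ∀ x, ‖fderiv ℝ (curl v) x‖ ≤ ‖(‖curlCLM‖ : ℝ) • iteratedFDeriv ℝ 2 v x‖ := fun x => by
    rw [norm_smul, Real.norm_of_nonneg (norm_nonneg _), ← norm_iteratedFDeriv_one]
    exact norm_iteratedFDeriv_curl_le_opNorm_mul hv 1 (by norm_num) x
  have n_D2w : ∀ x, ‖iteratedFDeriv ℝ 2 (curl v) x‖ ≤ ‖(‖curlCLM‖ : ℝ) • iteratedFDeriv ℝ 3 v x‖ := fun x => by
    rw [norm_smul, Real.norm_of_nonneg (norm_nonneg _)]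
    exact norm_iteratedFDeriv_curl_le_opNorm_mul hv 2 (by norm_num) x
  have n_Δ : ∀ x, ‖(Δ (curl v)) x‖ ≤ ‖(3 : ℝ) • iteratedFDeriv ℝ 2 (curl v) x‖ := fun x => by
    rw [norm_smul, Real.norm_of_nonneg (by norm_num : (0 : ℝ) ≤ 3)]
    exact norm_laplacian_le_three_mul_norm_iteratedFDeriv_two hw x
  -- finite `L²` norms
  have l2w : ∫⁻ x, ‖(curl v) x‖ₑ ^ 2 < ⊤ :=
    lintegral_enorm_sq_lt_top_of_norm_le n_w (lintegral_enorm_sq_const_smul_lt_top _ h1)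
  have l2Dw : ∫⁻ x, ‖fderiv ℝ (curl v) x‖ₑ ^ 2 < ⊤ :=
    lintegral_enorm_sq_lt_top_of_norm_le n_Dw (lintegral_enorm_sq_const_smul_lt_top _ h2)
  have l2D2w : ∫⁻ x, ‖iteratedFDeriv ℝ 2 (curl v) x‖ₑ ^ 2 < ⊤ :=
    lintegral_enorm_sq_lt_top_of_norm_le n_D2w (lintegral_enorm_sq_const_smul_lt_top _ h3)
  have l2Δ : ∫⁻ x, ‖(Δ (curl v)) x‖ₑ ^ 2 < ⊤ :=
    lintegral_enorm_sq_lt_top_of_norm_le n_Δ (lintegral_enorm_sq_const_smul_lt_top 3 l2D2w)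
  have l2diw : ∀ i, ∫⁻ x, ‖fderiv ℝ (curl v) x (e i)‖ₑ ^ 2 < ⊤ := fun i =>
    lintegral_enorm_sq_lt_top_of_norm_le (fun x => by
      simpa [he1] using (fderiv ℝ (curl v) x).le_opNorm (e i)) l2Dw
  have l2ddw : ∀ i, ∫⁻ x, ‖fderiv ℝ (fun y => fderiv ℝ (curl v) y (e i)) x (e i)‖ₑ ^ 2 < ⊤ := fun i =>
    lintegral_enorm_sq_lt_top_of_norm_le (fun x => norm_fderiv_fderiv_apply_basisFun_le hw x i) l2D2w
  -- the transport and stretching fields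
  have cconv : Continuous (convect v (curl v)) := cDw.clm_apply cv
  have cstr : Continuous (convect (curl v) v) := cDv.clm_apply cw
  have l2conv : ∫⁻ x, ‖convect v (curl v) x‖ₑ ^ 2 < ⊤ := by
    have hb : ∫⁻ x, ‖B * ‖fderiv ℝ (curl v) x‖‖ₑ ^ 2 < ⊤ := by
      have h := lintegral_enorm_sq_const_smul_lt_top B
        (lintegral_enorm_sq_lt_top_of_norm_le (fun x => by rw [norm_norm]) l2Dw :
          ∫⁻ x, ‖(‖fderiv ℝ (curl v) x‖)‖ₑ ^ 2 < ⊤)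
      simpa only [smul_eq_mul] using h
    refine lintegral_enorm_sq_lt_top_of_norm_le (fun x => ?_) hb
    rw [Real.norm_of_nonneg (by positivity), convect, mul_comm]
    exact (fderiv ℝ (curl v) x).le_opNorm_of_le (hB x)
  have l2str : ∫⁻ x, ‖convect (curl v) v x‖ₑ ^ 2 < ⊤ := by
    have hb : ∫⁻ x, ‖B₁ * ‖(curl v) x‖‖ₑ ^ 2 < ⊤ := by
      have h := lintegral_enorm_sq_const_smul_lt_top B₁
        (lintegral_enorm_sq_lt_top_of_norm_le (fun x => by rw [norm_norm]) l2w :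
          ∫⁻ x, ‖(‖(curl v) x‖)‖ₑ ^ 2 < ⊤)
      simpa only [smul_eq_mul] using h
    refine lintegral_enorm_sq_lt_top_of_norm_le (fun x => ?_) hb
    rw [Real.norm_of_nonneg (by positivity), convect]
    exact (fderiv ℝ v x).le_of_opNorm_le_of_le (hB₁ x) le_rfl
  -- integrability of the pairings with `(curl v)`
  have c3D2 : Continuous fun x => (3 : ℝ) • iteratedFDeriv ℝ 2 (curl v) x := cD2w.const_smul (3 : ℝ)
  have iwΔ : Integrable (fun x => ⟪(curl v) x, (Δ (curl v)) x⟫) volume :=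
    integrable_of_norm_le_mul_of_lintegral_sq (cw.inner cΔ).aestronglyMeasurable cw c3D2 l2w
      (lintegral_enorm_sq_const_smul_lt_top 3 l2D2w)
      fun x => (norm_inner_le_norm _ _).trans (mul_le_mul_of_nonneg_left (n_Δ x) (norm_nonneg _))
  have iwconv : Integrable (fun x => ⟪(curl v) x, convect v (curl v) x⟫) volume :=
    integrable_of_norm_le_mul_of_lintegral_sq (cw.inner cconv).aestronglyMeasurable cw cconv l2w
      l2conv fun x => norm_inner_le_norm _ _
  have iwstr : Integrable (fun x => ⟪(curl v) x, convect (curl v) v x⟫) volume :=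
    integrable_of_norm_le_mul_of_lintegral_sq (cw.inner cstr).aestronglyMeasurable cw cstr l2w
      l2str fun x => norm_inner_le_norm _ _
  -- (i) diffusion: `∫ ⟪(curl v), Δ(curl v)⟫ = -∫ |∇(curl v)|²`
  have ifrob : Integrable (fun x => frobeniusNormSq (fderiv ℝ (curl v) x)) volume := by
    have hlt : ∫⁻ x, ENNReal.ofReal (frobeniusNormSq (fderiv ℝ (curl v) x)) < ⊤ :=
      calc ∫⁻ x, ENNReal.ofReal (frobeniusNormSq (fderiv ℝ (curl v) x))
          ≤ ∫⁻ x, 3 * ‖fderiv ℝ (curl v) x‖ₑ ^ 2 :=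
            lintegral_mono fun x => ofReal_frobeniusNormSq_le_three_mul_enorm_sq _
        _ = 3 * ∫⁻ x, ‖fderiv ℝ (curl v) x‖ₑ ^ 2 := lintegral_const_mul' _ _ (by norm_num)
        _ < ⊤ := ENNReal.mul_lt_top (by norm_num) l2Dw
    exact integrable_of_continuous_of_nonneg (continuous_frobeniusNormSq_fderiv hw (by simp))
      (fun x => frobeniusNormSq_nonneg _) hlt
  have hlfrob : ∫⁻ x, ENNReal.ofReal (frobeniusNormSq (fderiv ℝ (curl v) x)) =
      ENNReal.ofReal (∫ x, frobeniusNormSq (fderiv ℝ (curl v) x)) :=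
    (ofReal_integral_eq_lintegral_ofReal ifrob
      (Eventually.of_forall fun x => frobeniusNormSq_nonneg _)).symm
  have hdiff : ∫ x, ⟪(curl v) x, (Δ (curl v)) x⟫ = - ∫ x, frobeniusNormSq (fderiv ℝ (curl v) x) := by
    have i1 : ∀ i, Integrable (fun x => ⟪fderiv ℝ (fun y => fderiv ℝ (curl v) y (e i)) x (e i), (curl v) x⟫)
        volume := fun i =>
      integrable_of_norm_le_mul_of_lintegral_sq ((cddw i).inner cw).aestronglyMeasurable (cddw i) cw
        (l2ddw i) l2w fun x => norm_inner_le_norm _ _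
    have i2 : ∀ i, Integrable (fun x => ⟪fderiv ℝ (curl v) x (e i), fderiv ℝ (curl v) x (e i)⟫) volume := fun i =>
      integrable_of_norm_le_mul_of_lintegral_sq ((cdiw i).inner (cdiw i)).aestronglyMeasurable
        (cdiw i) (cdiw i) (l2diw i) (l2diw i) fun x => norm_inner_le_norm _ _
    have i3 : ∀ i, Integrable (fun x => ⟪fderiv ℝ (curl v) x (e i), (curl v) x⟫) volume := fun i =>
      integrable_of_norm_le_mul_of_lintegral_sq ((cdiw i).inner cw).aestronglyMeasurable (cdiw i) cw
        (l2diw i) l2w fun x => norm_inner_le_norm _ _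
    have hG := integral_sum_inner_fderiv_fderiv_eq_neg_integral_inner_laplacian hw hw1 i1 i2 i3
    have hsum : ∫ x, ∑ i, ⟪fderiv ℝ (curl v) x (e i), fderiv ℝ (curl v) x (e i)⟫ =
        ∫ x, frobeniusNormSq (fderiv ℝ (curl v) x) := by
      refine integral_congr_ae (Eventually.of_forall fun x => ?_)
      simp only
      rw [frobeniusNormSq_eq_sum e]
      exact Finset.sum_congr rfl fun i _ => real_inner_self_eq_norm_sq _
    have hcomm : ∫ x, ⟪(curl v) x, (Δ (curl v)) x⟫ = ∫ x, ⟪(Δ (curl v)) x, (curl v) x⟫ :=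
      integral_congr_ae (Eventually.of_forall fun x => real_inner_comm _ _)
    rw [hcomm]
    linarith [hG, hsum]
  -- (ii) transport: `∫ ⟪(curl v), (v·∇)(curl v)⟫ = 0`
  have hwm : MemLp (curl v) 2 volume :=
    ⟨cw.aestronglyMeasurable, eLpNorm_two_lt_top_of_lintegral_enorm_sq_lt_top l2w⟩
  have htrans : ∫ x, ⟪(curl v) x, convect v (curl v) x⟫ = 0 := by
    have hwd : IsWeaklyDivFree v := VectorCalculus.IsDivFree.isWeaklyDivFree_holds hdiv hv1
    have hwg : HasWeakGradient (curl v) (fderiv ℝ (curl v)) := hasWeakGradient_fderiv_of_contDiff hw1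
    have hG2 : ∫⁻ x, ENNReal.ofReal (frobeniusNormSq (fderiv ℝ (curl v) x)) < ⊤ := by
      rw [hlfrob]; exact ENNReal.ofReal_lt_top
    have hvtop : MemLp v ⊤ volume :=
      memLp_top_of_bound cv.aestronglyMeasurable B (Eventually.of_forall hB)
    have h := integral_inner_weakGrad_apply_self_eq_zero hwd hwg hG2 hwm (q := ⊤) (p := 2)
      (by norm_num) hvtop hwm
    have hswap : (fun x => ⟪(curl v) x, convect v (curl v) x⟫) = fun x => ⟪fderiv ℝ (curl v) x (v x), (curl v) x⟫ :=
      funext fun x => by rw [convect, real_inner_comm]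
    rw [hswap]
    exact h
  -- (iii) the identity
  have hWeq : ∀ x, W x = ν • (Δ (curl v)) x - convect v (curl v) x + convect (curl v) v x := fun x => by
    have h' : W x = convect (curl v) v x + ν • (Δ (curl v)) x - convect v (curl v) x := eq_sub_of_add_eq (heq x)
    rw [h']
    abel
  have hint : ∫ x, ⟪(curl v) x, W x⟫ = ν * (∫ x, ⟪(curl v) x, (Δ (curl v)) x⟫) - (∫ x, ⟪(curl v) x, convect v (curl v) x⟫) +
      ∫ x, ⟪(curl v) x, convect (curl v) v x⟫ := by
    have h1 : (fun x => ⟪(curl v) x, W x⟫) = fun x => ν * ⟪(curl v) x, (Δ (curl v)) x⟫ - ⟪(curl v) x, convect v (curl v) x⟫ +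
        ⟪(curl v) x, convect (curl v) v x⟫ := by
      funext x
      rw [hWeq x, inner_add_right, inner_sub_right, real_inner_smul_right]
    have hI1 : Integrable (fun x => ν * ⟪(curl v) x, (Δ (curl v)) x⟫ - ⟪(curl v) x, convect v (curl v) x⟫) volume :=
      (iwΔ.const_mul ν).sub iwconv
    rw [h1, integral_add hI1 iwstr, integral_sub (iwΔ.const_mul ν) iwconv, integral_const_mul]
  rw [hint, hdiff, htrans]
  simp only [convect]
  ring

/-! ### Sup bound for the Hessian in the class -/

/-- **Sobolev imbedding on the velocity Hessian**: if the slices `u t`, `t ∈ S`, are `C⁴` and all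
`L²` Sobolev seminorms of `u` are bounded on `S`, then `‖D²u(t, x)‖ ≤ B` on `S × ℝ³`
(`W^{2,2}(ℝ³) ⊂ C_B(ℝ³)` applied to `D²u(t)`, whose seminorms are those of `u` shifted by two;
twin of `exists_forall_norm_fderiv_le_of_hasBoundedSobolevNormsOn`). [cite: Adams1975, Thm. 5.4 Part I Case C (mp > n)] -/
theorem exists_forall_norm_fderiv_fderiv_le_of_hasBoundedSobolevNormsOn {S : Set ℝ}
    {u : ℝ → (EuclideanSpace ℝ (Fin 3)) → (EuclideanSpace ℝ (Fin 3))} (hu : ∀ t ∈ S, ContDiff ℝ 4 (u t)) (hB : HasBoundedSobolevNormsOn S u) :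
    ∃ B : ℝ, 0 ≤ B ∧ ∀ t ∈ S, ∀ x, ‖fderiv ℝ (fderiv ℝ (u t)) x‖ ≤ B := by
  obtain ⟨K, hK, hbound⟩ := FunctionSpaces.exists_enorm_le_sobolev_two_two_dim_three
    (E := (EuclideanSpace ℝ (Fin 3))) (F := (EuclideanSpace ℝ (Fin 3)) →L[ℝ] (EuclideanSpace ℝ (Fin 3)) →L[ℝ] (EuclideanSpace ℝ (Fin 3))) (volume : Measure (EuclideanSpace ℝ (Fin 3))) finrank_euclideanSpace_fin
  choose C hC using hB
  set R : ℝ≥0∞ := K * ∑ j ∈ Finset.range 3, ((C (j + 2) : ℝ≥0∞) ^ (1 / 2 : ℝ)) with hR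
  have hRtop : R < ⊤ := by
    refine ENNReal.mul_lt_top hK (ENNReal.sum_lt_top.2 fun j _ => ?_)
    exact ENNReal.rpow_lt_top_of_nonneg (by norm_num) ENNReal.coe_ne_top
  refine ⟨R.toReal, ENNReal.toReal_nonneg, fun t ht x => ?_⟩
  have hD : ContDiff ℝ 2 (fderiv ℝ (fderiv ℝ (u t))) :=
    ((hu t ht).fderiv_right (m := 3) (by norm_num)).fderiv_right (m := 2) (by norm_num)
  have h1 : ‖fderiv ℝ (fderiv ℝ (u t)) x‖ₑ ≤ R := by
    refine (hbound (fderiv ℝ (fderiv ℝ (u t))) hD x).trans ?_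
    rw [hR]
    gcongr with j hj
    refine eLpNorm_two_le_rpow_of_lintegral_sq_le ?_
    refine le_of_eq_of_le (lintegral_congr fun y => ?_) (hC (j + 2) t ht)
    rw [← ofReal_norm, norm_iteratedFDeriv_fderiv, norm_iteratedFDeriv_fderiv, ofReal_norm]
  calc ‖fderiv ℝ (fderiv ℝ (u t)) x‖ = (‖fderiv ℝ (fderiv ℝ (u t)) x‖ₑ).toReal := (toReal_enorm _).symm
    _ ≤ R.toReal := ENNReal.toReal_mono hRtop.ne h1

/-! ### `∫⁻ ‖f‖ₑ²` under a three-term pointwise bound -/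

/-- If `‖f‖ ≤ a‖g₁‖ + b‖g₂‖ + c‖g₃‖` pointwise (`a, b, c ≥ 0`, `g₁, g₂, g₃` continuous), then
`∫⁻ ‖f‖ₑ² ≤ 3 (a² ∫⁻‖g₁‖ₑ² + b² ∫⁻‖g₂‖ₑ² + c² ∫⁻‖g₃‖ₑ²)`. [folklore] -/
theorem lintegral_enorm_sq_le_of_norm_le_three {F G₁ G₂ G₃ : Type*} [NormedAddCommGroup F]
    [NormedAddCommGroup G₁] [NormedAddCommGroup G₂] [NormedAddCommGroup G₃]
    {f : (EuclideanSpace ℝ (Fin 3)) → F} {g₁ : (EuclideanSpace ℝ (Fin 3)) → G₁} {g₂ : (EuclideanSpace ℝ (Fin 3)) → G₂} {g₃ : (EuclideanSpace ℝ (Fin 3)) → G₃}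
    (hg₁ : Continuous g₁) (hg₂ : Continuous g₂) (hg₃ : Continuous g₃) {a b c : ℝ} (ha : 0 ≤ a)
    (hb : 0 ≤ b) (hc : 0 ≤ c) (hle : ∀ x, ‖f x‖ ≤ a * ‖g₁ x‖ + b * ‖g₂ x‖ + c * ‖g₃ x‖) :
    ∫⁻ x, ‖f x‖ₑ ^ 2 ≤ 3 * (ENNReal.ofReal (a ^ 2) * (∫⁻ x, ‖g₁ x‖ₑ ^ 2) +
      ENNReal.ofReal (b ^ 2) * (∫⁻ x, ‖g₂ x‖ₑ ^ 2) + ENNReal.ofReal (c ^ 2) * (∫⁻ x, ‖g₃ x‖ₑ ^ 2)) := by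
  have hpt : ∀ x, ‖f x‖ₑ ^ 2 ≤ 3 * (ENNReal.ofReal (a ^ 2) * ‖g₁ x‖ₑ ^ 2 +
      ENNReal.ofReal (b ^ 2) * ‖g₂ x‖ₑ ^ 2 + ENNReal.ofReal (c ^ 2) * ‖g₃ x‖ₑ ^ 2) := by
    intro x
    have hreal : ‖f x‖ ^ 2 ≤ 3 * (a ^ 2 * ‖g₁ x‖ ^ 2 + b ^ 2 * ‖g₂ x‖ ^ 2 + c ^ 2 * ‖g₃ x‖ ^ 2) := by
      have h := hle x
      have h0 : 0 ≤ a * ‖g₁ x‖ + b * ‖g₂ x‖ + c * ‖g₃ x‖ := by positivity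
      calc ‖f x‖ ^ 2 ≤ (a * ‖g₁ x‖ + b * ‖g₂ x‖ + c * ‖g₃ x‖) ^ 2 :=
            pow_le_pow_left₀ (norm_nonneg _) h 2
        _ ≤ 3 * (a ^ 2 * ‖g₁ x‖ ^ 2 + b ^ 2 * ‖g₂ x‖ ^ 2 + c ^ 2 * ‖g₃ x‖ ^ 2) := by
            nlinarith [sq_nonneg (a * ‖g₁ x‖ - b * ‖g₂ x‖), sq_nonneg (b * ‖g₂ x‖ - c * ‖g₃ x‖),
              sq_nonneg (a * ‖g₁ x‖ - c * ‖g₃ x‖)]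
    have e1 : ‖f x‖ₑ ^ 2 = ENNReal.ofReal (‖f x‖ ^ 2) := by
      rw [← ofReal_norm, ENNReal.ofReal_pow (norm_nonneg _)]
    have e2 : 3 * (ENNReal.ofReal (a ^ 2) * ‖g₁ x‖ₑ ^ 2 + ENNReal.ofReal (b ^ 2) * ‖g₂ x‖ₑ ^ 2 +
        ENNReal.ofReal (c ^ 2) * ‖g₃ x‖ₑ ^ 2) =
        ENNReal.ofReal (3 * (a ^ 2 * ‖g₁ x‖ ^ 2 + b ^ 2 * ‖g₂ x‖ ^ 2 + c ^ 2 * ‖g₃ x‖ ^ 2)) := by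
      rw [ENNReal.ofReal_mul (by norm_num), ENNReal.ofReal_add (by positivity) (by positivity),
        ENNReal.ofReal_add (by positivity) (by positivity), ENNReal.ofReal_mul (sq_nonneg _),
        ENNReal.ofReal_mul (sq_nonneg _), ENNReal.ofReal_mul (sq_nonneg _),
        ENNReal.ofReal_pow (norm_nonneg _), ENNReal.ofReal_pow (norm_nonneg _),
        ENNReal.ofReal_pow (norm_nonneg _), ofReal_norm, ofReal_norm, ofReal_norm]
      norm_num
    rw [e1, e2]
    exact ENNReal.ofReal_le_ofReal hreal
  have m1 : Measurable fun x => ENNReal.ofReal (a ^ 2) * ‖g₁ x‖ₑ ^ 2 :=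
    (hg₁.enorm.measurable.pow_const 2).const_mul _
  have m2 : Measurable fun x => ENNReal.ofReal (b ^ 2) * ‖g₂ x‖ₑ ^ 2 :=
    (hg₂.enorm.measurable.pow_const 2).const_mul _
  have m3 : Measurable fun x => ENNReal.ofReal (c ^ 2) * ‖g₃ x‖ₑ ^ 2 :=
    (hg₃.enorm.measurable.pow_const 2).const_mul _
  calc ∫⁻ x, ‖f x‖ₑ ^ 2 ≤ ∫⁻ x, 3 * (ENNReal.ofReal (a ^ 2) * ‖g₁ x‖ₑ ^ 2 +
        ENNReal.ofReal (b ^ 2) * ‖g₂ x‖ₑ ^ 2 + ENNReal.ofReal (c ^ 2) * ‖g₃ x‖ₑ ^ 2) :=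
        lintegral_mono hpt
    _ = 3 * (ENNReal.ofReal (a ^ 2) * (∫⁻ x, ‖g₁ x‖ₑ ^ 2) +
          ENNReal.ofReal (b ^ 2) * (∫⁻ x, ‖g₂ x‖ₑ ^ 2) + ENNReal.ofReal (c ^ 2) * (∫⁻ x, ‖g₃ x‖ₑ ^ 2)) := by
        rw [lintegral_const_mul' _ _ (by norm_num), lintegral_add_left (m1.fun_add m2),
          lintegral_add_left m1, lintegral_const_mul' _ _ ENNReal.ofReal_ne_top,
          lintegral_const_mul' _ _ ENNReal.ofReal_ne_top, lintegral_const_mul' _ _ ENNReal.ofReal_ne_top]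

/-- `ofReal (∫ f) ≤ ∫⁻ ofReal f` for every real function (junk value `0` if not integrable). [folklore] -/
private theorem ofReal_integral_le_lintegral_ofReal' {α : Type*} [MeasurableSpace α] {μ : Measure α}
    (f : α → ℝ) : ENNReal.ofReal (∫ x, f x ∂μ) ≤ ∫⁻ x, ENNReal.ofReal (f x) ∂μ := by
  by_cases hf : Integrable f μ
  · have hpos : Integrable (fun x => max (f x) 0) μ := hf.pos_part
    have h1 : ∫ x, f x ∂μ ≤ ∫ x, max (f x) 0 ∂μ := integral_mono hf hpos fun x => le_max_left _ _
    have h2 : ENNReal.ofReal (∫ x, max (f x) 0 ∂μ) = ∫⁻ x, ENNReal.ofReal (max (f x) 0) ∂μ :=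
      ofReal_integral_eq_lintegral_ofReal hpos (Eventually.of_forall fun x => le_max_right _ _)
    have h3 : ∫⁻ x, ENNReal.ofReal (max (f x) 0) ∂μ = ∫⁻ x, ENNReal.ofReal (f x) ∂μ := by
      refine lintegral_congr fun x => ?_
      rcases le_total (f x) 0 with h | h
      · rw [max_eq_right h, ENNReal.ofReal_of_nonpos h, ENNReal.ofReal_zero]
      · rw [max_eq_left h]
    calc ENNReal.ofReal (∫ x, f x ∂μ) ≤ ENNReal.ofReal (∫ x, max (f x) 0 ∂μ) := ENNReal.ofReal_le_ofReal h1
      _ = ∫⁻ x, ENNReal.ofReal (f x) ∂μ := by rw [h2, h3]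
  · rw [integral_undef hf, ENNReal.ofReal_zero]
    exact zero_le

/-! ### The enstrophy on a closed slab under the direction hypothesis -/

/-- The zero force is curl free — DEPRECATED duplicate of the tree's `curl_zero` (librarian dedup
2026-08-16, work item dedup-01246); kept under its old name as a one-line alias proof (never
deleted), no longer used in this file. [folklore] -/
@[deprecated curl_zero (since := "2026-08-16")]
theorem curl_zero_field_apply (x : (EuclideanSpace ℝ (Fin 3))) : curl (0 : (EuclideanSpace ℝ (Fin 3)) → (EuclideanSpace ℝ (Fin 3))) x = 0 :=
  curl_zero x

set_option maxHeartbeats 1600000 in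
/-- **The enstrophy bound on a closed slab** (the Grönwall step of Constantin–Fefferman's theorem;
Lemarié-Rieusset 2016, end of the proof of Thm. 11.7: "and we conclude with Grönwall's lemma").
Let `(u, p)` be a classical unforced Navier–Stokes solution on the closed slab `[0, T''] × ℝ³`,
`ν > 0`, with all `L²` Sobolev seminorms bounded there, energy `‖u(t)‖²₂ ≤ Ē` and dissipation
`∫₀^{T''}∫|∇u|² ≤ I`, and assume Constantin–Fefferman's direction hypothesis on `{|ω| > Ω}` with
constants `Ω, ρ`. With the constants `C₁, …, C₄` of the fixed-time stretching estimate
(`exists_two_mul_integral_stretching_le`, depending on `ν, Ω, ρ` only),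
`∫|ω(t)|² ≤ (∫|ω(0)|² + C₄ I) exp((C₁ + C₃Ē)T'' + C₂‖curl‖²I)` for all `t ∈ [0, T'']`. [cite: ConstantinFeffermanIndiana1993, §2 (the enstrophy bound); LemarieRieusset2016, Thm. 11.7 (proof, PDF p. 371)] -/
theorem integral_sq_norm_curl_le_of_direction_slab {ν T'' : ℝ} (hν : 0 < ν) (hT'' : 0 < T'')
    {u : ℝ → (EuclideanSpace ℝ (Fin 3)) → (EuclideanSpace ℝ (Fin 3))} {p : ℝ → (EuclideanSpace ℝ (Fin 3)) → ℝ} (hS : IsClassicalNSSolutionOn (Icc 0 T'') ν 0 u p)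
    (hB : HasBoundedSobolevNormsOn (Icc 0 T'') u) {Ē I : ℝ} (hĒ : 0 ≤ Ē) (hI : 0 ≤ I)
    (hen : ∀ t ∈ Icc 0 T'', ∫⁻ x, ‖u t x‖ₑ ^ 2 ≤ ENNReal.ofReal Ē)
    (hdiss : ∫⁻ t in Ioo 0 T'', ∫⁻ x, ENNReal.ofReal (frobeniusNormSq (fderiv ℝ (u t) x)) ≤
      ENNReal.ofReal I)
    {C₁ C₂ C₃ C₄ : ℝ} (hC₁ : 0 ≤ C₁) (hC₂ : 0 ≤ C₂) (hC₃ : 0 ≤ C₃) (hC₄ : 0 ≤ C₄)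
    (hstr : ∀ t ∈ Icc 0 T'',
      2 * ∫ x, ⟪curl (u t) x, fderiv ℝ (u t) x (curl (u t) x)⟫ ≤
        ν * (∫ x, frobeniusNormSq (fderiv ℝ (curl (u t)) x)) +
          (C₁ + C₂ * (∫ x, ‖curl (u t) x‖ ^ 2) + C₃ * (∫ x, ‖u t x‖ ^ 2)) *
            (∫ x, ‖curl (u t) x‖ ^ 2) +
          C₄ * (∫ x, frobeniusNormSq (fderiv ℝ (u t) x))) :
    ∀ t ∈ Icc 0 T'', ∫ x, ‖curl (u t) x‖ ^ 2 ≤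
      ((∫ x, ‖curl (u 0) x‖ ^ 2) + C₄ * I) *
        Real.exp ((C₁ + C₃ * Ē) * T'' + C₂ * (‖curlCLM‖ ^ 2 * I)) := by
  have hU : UniqueDiffOn ℝ (Icc 0 T'') := uniqueDiffOn_Icc hT''
  have h0S : (0 : ℝ) ∈ Icc 0 T'' := ⟨le_rfl, hT''.le⟩
  set κ : ℝ := ‖curlCLM‖ with hκ
  -- smoothness of the slices
  have hsm : ∀ t ∈ Icc 0 T'', ContDiff ℝ ∞ (u t) := fun t ht => hS.contDiff_velocity ht
  have hsm4 : ∀ t ∈ Icc 0 T'', ContDiff ℝ 4 (u t) := fun t ht => (hsm t ht).of_le (by norm_cast)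
  have hsm3 : ∀ t ∈ Icc 0 T'', ContDiff ℝ 3 (u t) := fun t ht => (hsm t ht).of_le (by norm_cast)
  have hsm2 : ∀ t ∈ Icc 0 T'', ContDiff ℝ 2 (u t) := fun t ht => (hsm t ht).of_le (by norm_cast)
  -- sup bounds
  obtain ⟨B₀, hB₀⟩ := linfty_bound_of_hasBoundedSobolevNormsOn_holds hsm2 hB
  obtain ⟨B₁, hB₁0, hB₁⟩ := exists_forall_norm_fderiv_le_of_hasBoundedSobolevNormsOn hsm3 hB
  obtain ⟨B₂, hB₂0, hB₂⟩ := exists_forall_norm_fderiv_fderiv_le_of_hasBoundedSobolevNormsOn hsm4 hB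
  have hB₀0 : 0 ≤ B₀ := (norm_nonneg _).trans (hB₀ 0 h0S 0)
  -- the Sobolev bounds
  have hfin : ∀ n, ∀ t ∈ Icc 0 T'', ∫⁻ x, ‖iteratedFDeriv ℝ n (u t) x‖ₑ ^ 2 < ⊤ := fun n t ht => by
    obtain ⟨C, hC⟩ := hB n
    exact (hC t ht).trans_lt ENNReal.coe_lt_top
  choose Cn hCn using hB
  -- the vorticity field and its time derivative
  set vort : ℝ → (EuclideanSpace ℝ (Fin 3)) → (EuclideanSpace ℝ (Fin 3)) := vorticity u with hωdef
  have hωt : ∀ t, vort t = curl (u t) := fun t => rfl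
  have hωsm : IsSmoothSpaceTimeOn (Icc 0 T'') vort :=
    (hS.smooth_velocity.fderiv_slice hU).clm_comp curlCLM
  set W : ℝ → (EuclideanSpace ℝ (Fin 3)) → (EuclideanSpace ℝ (Fin 3)) := timeDerivWithin (Icc 0 T'') vort with hWdef
  have hWsm : IsSmoothSpaceTimeOn (Icc 0 T'') W := hωsm.timeDerivWithin hU
  have hvort : ∀ t ∈ Icc 0 T'', ∀ x,
      W t x + convect (u t) (vort t) x = convect (vort t) (u t) x + ν • (Δ (vort t)) x := fun t ht x =>
    (hS.isVorticitySolutionOn_of_uniqueDiffOn hU (fun s _ y => curl_zero y)).vorticity_eq t ht x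
  -- `L²` bound for the vorticity
  set V₀ : ℝ≥0∞ := ENNReal.ofReal (κ ^ 2) * (Cn 1 : ℝ≥0∞) with hV₀
  have hV₀top : V₀ < ⊤ := ENNReal.mul_lt_top ENNReal.ofReal_lt_top ENNReal.coe_lt_top
  have hωL2 : ∀ t ∈ Icc 0 T'', ∫⁻ x, ‖vort t x‖ₑ ^ 2 ≤ V₀ := fun t ht =>
    (lintegral_curl_sq_le (u t)).trans (mul_le_mul' le_rfl (hCn 1 t ht))
  -- `L²` bound for the time derivative of the vorticity
  set V₁ : ℝ≥0∞ := 3 * (ENNReal.ofReal ((ν * (3 * κ)) ^ 2) * (Cn 3 : ℝ≥0∞) +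
    ENNReal.ofReal ((B₀ * κ) ^ 2) * (Cn 2 : ℝ≥0∞) + ENNReal.ofReal ((B₁ * κ) ^ 2) * (Cn 1 : ℝ≥0∞))
    with hV₁
  have hV₁top : V₁ < ⊤ := by
    refine ENNReal.mul_lt_top (by norm_num) ?_
    refine ENNReal.add_lt_top.2 ⟨ENNReal.add_lt_top.2 ⟨?_, ?_⟩, ?_⟩ <;>
      exact ENNReal.mul_lt_top ENNReal.ofReal_lt_top ENNReal.coe_lt_top
  have hWL2 : ∀ t ∈ Icc 0 T'', ∫⁻ x, ‖W t x‖ₑ ^ 2 ≤ V₁ := by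
    intro t ht
    have hv := hsm3 t ht
    have hpt : ∀ x, ‖W t x‖ ≤ (ν * (3 * κ)) * ‖iteratedFDeriv ℝ 3 (u t) x‖ +
        (B₀ * κ) * ‖iteratedFDeriv ℝ 2 (u t) x‖ + (B₁ * κ) * ‖iteratedFDeriv ℝ 1 (u t) x‖ := by
      intro x
      have hw2 : ContDiff ℝ 2 (curl (u t)) := contDiff_curl (n := 2) (by exact hv)
      have heq : W t x = ν • (Δ (vort t)) x - convect (u t) (vort t) x + convect (vort t) (u t) x := by
        have h := hvort t ht x
        have : W t x = convect (vort t) (u t) x + ν • (Δ (vort t)) x - convect (u t) (vort t) x :=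
          eq_sub_of_add_eq h
        rw [this]; abel
      rw [heq, hωt]
      have t1 : ‖ν • (Δ (curl (u t))) x‖ ≤ (ν * (3 * κ)) * ‖iteratedFDeriv ℝ 3 (u t) x‖ := by
        rw [norm_smul, Real.norm_of_nonneg hν.le, mul_assoc, mul_assoc]
        refine mul_le_mul_of_nonneg_left ?_ hν.le
        calc ‖(Δ (curl (u t))) x‖ ≤ 3 * ‖iteratedFDeriv ℝ 2 (curl (u t)) x‖ :=
              norm_laplacian_le_three_mul_norm_iteratedFDeriv_two hw2 x
          _ ≤ 3 * (κ * ‖iteratedFDeriv ℝ 3 (u t) x‖) :=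
              mul_le_mul_of_nonneg_left (norm_iteratedFDeriv_curl_le_opNorm_mul hv 2 (by norm_num) x) (by norm_num)
      have t2 : ‖convect (u t) (curl (u t)) x‖ ≤ (B₀ * κ) * ‖iteratedFDeriv ℝ 2 (u t) x‖ := by
        rw [convect]
        calc ‖fderiv ℝ (curl (u t)) x (u t x)‖ ≤ ‖fderiv ℝ (curl (u t)) x‖ * ‖u t x‖ :=
              ContinuousLinearMap.le_opNorm _ _
          _ ≤ (κ * ‖iteratedFDeriv ℝ 2 (u t) x‖) * B₀ := by
              refine mul_le_mul ?_ (hB₀ t ht x) (norm_nonneg _) (by positivity)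
              rw [← norm_iteratedFDeriv_one]
              exact norm_iteratedFDeriv_curl_le_opNorm_mul hv 1 (by norm_num) x
          _ = (B₀ * κ) * ‖iteratedFDeriv ℝ 2 (u t) x‖ := by ring
      have t3 : ‖convect (curl (u t)) (u t) x‖ ≤ (B₁ * κ) * ‖iteratedFDeriv ℝ 1 (u t) x‖ := by
        rw [convect]
        calc ‖fderiv ℝ (u t) x (curl (u t) x)‖ ≤ ‖fderiv ℝ (u t) x‖ * ‖curl (u t) x‖ :=
              ContinuousLinearMap.le_opNorm _ _
          _ ≤ B₁ * (κ * ‖iteratedFDeriv ℝ 1 (u t) x‖) := by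
              refine mul_le_mul (hB₁ t ht x) ?_ (norm_nonneg _) hB₁0
              have h := norm_iteratedFDeriv_curl_le_opNorm_mul hv 0 (by norm_num) x
              rwa [norm_iteratedFDeriv_zero] at h
          _ = (B₁ * κ) * ‖iteratedFDeriv ℝ 1 (u t) x‖ := by ring
      have e1 : ‖ν • (Δ (curl (u t))) x - convect (u t) (curl (u t)) x + convect (curl (u t)) (u t) x‖ ≤
          ‖ν • (Δ (curl (u t))) x - convect (u t) (curl (u t)) x‖ + ‖convect (curl (u t)) (u t) x‖ :=
        norm_add_le _ _
      have e2 : ‖ν • (Δ (curl (u t))) x - convect (u t) (curl (u t)) x‖ ≤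
          ‖ν • (Δ (curl (u t))) x‖ + ‖convect (u t) (curl (u t)) x‖ := norm_sub_le _ _
      linarith [e1, e2, t1, t2, t3]
    refine (lintegral_enorm_sq_le_of_norm_le_three ((hv.continuous_iteratedFDeriv le_rfl))
      (hv.continuous_iteratedFDeriv (by norm_num)) (hv.continuous_iteratedFDeriv (by norm_num))
      (by positivity) (by positivity) (by positivity) hpt).trans ?_
    rw [hV₁]
    exact mul_le_mul' le_rfl (add_le_add (add_le_add (mul_le_mul' le_rfl (hCn 3 t ht))
      (mul_le_mul' le_rfl (hCn 2 t ht))) (mul_le_mul' le_rfl (hCn 1 t ht)))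
  -- the balance of the enstrophy
  obtain ⟨-, hYcont, hbal⟩ := hωsm.l2_balance hT'' (C₀ := V₀.toNNReal) (C₁ := V₁.toNNReal)
    (fun t ht => by rw [ENNReal.coe_toNNReal hV₀top.ne]; exact hωL2 t ht)
    (fun t ht => by rw [ENNReal.coe_toNNReal hV₁top.ne]; exact hWL2 t ht)
  -- the quantities
  set Y : ℝ → ℝ := fun t => ∫ x, ‖vort t x‖ ^ 2 with hYdef
  set F : ℝ → ℝ := fun t => ∫ x, frobeniusNormSq (fderiv ℝ (u t) x) with hFdef
  set Φ : ℝ → ℝ := fun t => ∫ x, 2 * ⟪vort t x, W t x⟫ with hΦdef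
  have hY0 : ∀ t, 0 ≤ Y t := fun t => integral_nonneg fun x => sq_nonneg _
  have hF0 : ∀ t, 0 ≤ F t := fun t => integral_nonneg fun x => frobeniusNormSq_nonneg _
  -- real energy and its bound
  have hEreal : ∀ t ∈ Icc 0 T'', ∫ x, ‖u t x‖ ^ 2 ≤ Ē := by
    intro t ht
    have hfin0 : ∫⁻ x, ‖u t x‖ₑ ^ 2 < ⊤ := (hen t ht).trans_lt ENNReal.ofReal_lt_top
    have hi : Integrable fun x => ‖u t x‖ ^ 2 := integrable_sq_norm_of_lintegral_lt_top (hsm t ht).continuous hfin0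
    have h := hen t ht
    rw [show (∫⁻ x, ‖u t x‖ₑ ^ 2) = ∫⁻ x, ENNReal.ofReal (‖u t x‖ ^ 2) from
      lintegral_congr fun x => by rw [← ofReal_norm, ENNReal.ofReal_pow (norm_nonneg _)],
      ← ofReal_integral_eq_lintegral_ofReal hi (Eventually.of_forall fun x => sq_nonneg _)] at h
    exact (ENNReal.ofReal_le_ofReal_iff hĒ).1 h
  -- integrability of `|∇u(t)|²_F`, and `F` versus the dissipation
  have hFint : ∀ t ∈ Icc 0 T'', Integrable fun x => frobeniusNormSq (fderiv ℝ (u t) x) := by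
    intro t ht
    have hlt : ∫⁻ x, ENNReal.ofReal (frobeniusNormSq (fderiv ℝ (u t) x)) < ⊤ := by
      calc ∫⁻ x, ENNReal.ofReal (frobeniusNormSq (fderiv ℝ (u t) x))
          ≤ ∫⁻ x, 3 * ‖fderiv ℝ (u t) x‖ₑ ^ 2 :=
            lintegral_mono fun x => ofReal_frobeniusNormSq_le_three_mul_enorm_sq _
        _ = 3 * ∫⁻ x, ‖iteratedFDeriv ℝ 1 (u t) x‖ₑ ^ 2 := by
            rw [lintegral_const_mul' _ _ (by norm_num)]
            congr 1
            exact lintegral_congr fun x => by rw [← ofReal_norm, ← norm_iteratedFDeriv_one, ofReal_norm]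
        _ < ⊤ := ENNReal.mul_lt_top (by norm_num) (hfin 1 t ht)
    exact integrable_of_continuous_of_nonneg (continuous_frobeniusNormSq_fderiv (hsm2 t ht) (by simp))
      (fun x => frobeniusNormSq_nonneg _) hlt
  have hFof : ∀ t ∈ Icc 0 T'', ENNReal.ofReal (F t) =
      ∫⁻ x, ENNReal.ofReal (frobeniusNormSq (fderiv ℝ (u t) x)) := fun t ht =>
    ofReal_integral_eq_lintegral_ofReal (hFint t ht) (Eventually.of_forall fun x => frobeniusNormSq_nonneg _)
  have hIF : ∫⁻ t in Ioo 0 T'', ENNReal.ofReal (F t) ≤ ENNReal.ofReal I := by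
    refine le_trans (le_of_eq ?_) hdiss
    exact setLIntegral_congr_fun measurableSet_Ioo fun t ht => hFof t ⟨ht.1.le, ht.2.le⟩
  -- `Y ≤ κ² F` and `Y ≤ V₀`
  have hYle : ∀ t ∈ Icc 0 T'', Y t ≤ κ ^ 2 * F t := by
    intro t ht
    have hi : Integrable fun x => ‖vort t x‖ ^ 2 := by
      refine integrable_sq_norm_of_lintegral_lt_top (hωsm.contDiff_slice ht).continuous ?_
      exact (hωL2 t ht).trans_lt hV₀top
    rw [hYdef, hFdef]
    show (∫ x, ‖vort t x‖ ^ 2) ≤ κ ^ 2 * ∫ x, frobeniusNormSq (fderiv ℝ (u t) x)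
    rw [← integral_const_mul]
    refine integral_mono hi ((hFint t ht).const_mul _) fun x => ?_
    show ‖vort t x‖ ^ 2 ≤ κ ^ 2 * frobeniusNormSq (fderiv ℝ (u t) x)
    rw [hωt]
    calc ‖curl (u t) x‖ ^ 2 ≤ (κ * ‖fderiv ℝ (u t) x‖) ^ 2 :=
          pow_le_pow_left₀ (norm_nonneg _) (norm_curl_le _ _) 2
      _ = κ ^ 2 * ‖fderiv ℝ (u t) x‖ ^ 2 := by ring
      _ ≤ κ ^ 2 * frobeniusNormSq (fderiv ℝ (u t) x) :=
          mul_le_mul_of_nonneg_left (sq_opNorm_le_frobeniusNormSq _) (sq_nonneg _)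
  have hYV : ∀ t ∈ Icc 0 T'', ENNReal.ofReal (Y t) ≤ V₀ := by
    intro t ht
    have hi : Integrable fun x => ‖vort t x‖ ^ 2 := by
      refine integrable_sq_norm_of_lintegral_lt_top (hωsm.contDiff_slice ht).continuous ?_
      exact (hωL2 t ht).trans_lt hV₀top
    rw [hYdef]
    show ENNReal.ofReal (∫ x, ‖vort t x‖ ^ 2) ≤ V₀
    rw [ofReal_integral_eq_lintegral_ofReal hi (Eventually.of_forall fun x => sq_nonneg _)]
    refine le_trans (le_of_eq (lintegral_congr fun x => ?_)) (hωL2 t ht)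
    rw [← ofReal_norm, ENNReal.ofReal_pow (norm_nonneg _)]
  -- the slice inequality `Φ t ≤ ā t Y t + C₄ F t`
  set ā : ℝ → ℝ := fun t => C₁ + C₂ * Y t + C₃ * Ē with hādef
  have hā0 : ∀ t, 0 ≤ ā t := fun t => by positivity
  have hslice : ∀ t ∈ Icc 0 T'', Φ t ≤ ā t * Y t + C₄ * F t := by
    intro t ht
    have hv := hsm3 t ht
    have hid := integral_inner_curl_eq_of_vorticity_eq hv (hS.divFree t ht) (hvort t ht)
      (hB₀ t ht) (hB₁ t ht) (hfin 1 t ht) (hfin 2 t ht) (hfin 3 t ht)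
    -- integrability hypotheses of the stretching estimate
    have hvc := (hsm t ht).continuous
    have i0 : Integrable fun x => ‖u t x‖ ^ 2 :=
      integrable_sq_norm_of_lintegral_lt_top hvc ((hen t ht).trans_lt ENNReal.ofReal_lt_top)
    have i1 : Integrable fun x => ‖fderiv ℝ (u t) x‖ ^ 2 := by
      have h := integrable_sq_norm_of_lintegral_lt_top (hv.continuous_iteratedFDeriv (by norm_num)) (hfin 1 t ht)
      exact h.congr (Eventually.of_forall fun x => by simp only [norm_iteratedFDeriv_one])
    have i2 : Integrable fun x => ‖fderiv ℝ (fderiv ℝ (u t)) x‖ ^ 2 := by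
      have h := integrable_sq_norm_of_lintegral_lt_top (hv.continuous_iteratedFDeriv (by norm_num)) (hfin 2 t ht)
      refine h.congr (Eventually.of_forall fun x => ?_)
      show ‖iteratedFDeriv ℝ 2 (u t) x‖ ^ 2 = ‖fderiv ℝ (fderiv ℝ (u t)) x‖ ^ 2
      rw [← norm_iteratedFDeriv_fderiv, norm_iteratedFDeriv_one]
    have hst := hstr t ht
    have hE := hEreal t ht
    have hDnn : 0 ≤ ∫ x, frobeniusNormSq (fderiv ℝ (curl (u t)) x) :=
      integral_nonneg fun x => frobeniusNormSq_nonneg _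
    have hΦt : Φ t = 2 * ∫ x, ⟪vort t x, W t x⟫ := by
      rw [hΦdef]
      exact integral_const_mul _ _
    rw [hΦt, hωt, hid]
    have hYt : Y t = ∫ x, ‖curl (u t) x‖ ^ 2 := rfl
    rw [hādef, hFdef]
    show 2 * (-ν * (∫ x, frobeniusNormSq (fderiv ℝ (curl (u t)) x)) +
        ∫ x, ⟪curl (u t) x, fderiv ℝ (u t) x (curl (u t) x)⟫) ≤
      (C₁ + C₂ * Y t + C₃ * Ē) * Y t + C₄ * ∫ x, frobeniusNormSq (fderiv ℝ (u t) x)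
    rw [hYt]
    have hY0' : 0 ≤ ∫ x, ‖curl (u t) x‖ ^ 2 := integral_nonneg fun x => sq_nonneg _
    have hmono : (C₁ + C₂ * (∫ x, ‖curl (u t) x‖ ^ 2) + C₃ * (∫ x, ‖u t x‖ ^ 2)) *
        (∫ x, ‖curl (u t) x‖ ^ 2) ≤
        (C₁ + C₂ * (∫ x, ‖curl (u t) x‖ ^ 2) + C₃ * Ē) * (∫ x, ‖curl (u t) x‖ ^ 2) := by
      gcongr
    nlinarith [hst, hmono, hν, hDnn]
  -- Grönwall, lower-integral form
  set φ : ℝ → ℝ≥0∞ := fun t => ENNReal.ofReal (Y t) with hφdef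
  set a : ℝ → ℝ≥0∞ := fun t => ENNReal.ofReal (ā t) with hadef
  set Bg : ℝ≥0∞ := ENNReal.ofReal (Y 0 + C₄ * I) with hBg
  have hāY_cont : ContinuousOn (fun t => ā t * Y t) (Icc 0 T'') := by
    have hYc : ContinuousOn Y (Icc 0 T'') := hYcont
    exact ((continuousOn_const.add (continuousOn_const.mul hYc)).add continuousOn_const).mul hYc
  have hineq : ∀ b ∈ Icc 0 T'', φ b ≤ Bg + ∫⁻ s in Ioo 0 b, a s * φ s := by
    intro b hb
    rcases eq_or_lt_of_le hb.1 with h0 | hb0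
    · rw [← h0]
      simp only [Ioo_self, Measure.restrict_empty, lintegral_zero_measure, add_zero]
      rw [hφdef, hBg]
      exact ENNReal.ofReal_le_ofReal (le_add_of_nonneg_right (by positivity))
    have hbalb := hbal b ⟨hb0, hb.2⟩
    -- `Y b = Y 0 + ∫₀ᵇ Φ`
    have hYb : Y b = Y 0 + ∫ t in Ioo 0 b, Φ t := by
      have h : (∫ x, ‖vort b x‖ ^ 2) = (∫ x, ‖vort 0 x‖ ^ 2) + ∫ t in (0 : ℝ)..b, Φ t := hbalb
      rw [intervalIntegral.integral_of_le hb0.le, integral_Ioc_eq_integral_Ioo] at h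
      exact h
    -- pointwise bound on `(0, b)`
    have hpt : ∀ t ∈ Ioo 0 b, ENNReal.ofReal (Φ t) ≤
        ENNReal.ofReal (ā t * Y t) + ENNReal.ofReal (C₄ * F t) := by
      intro t ht
      have htS : t ∈ Icc 0 T'' := ⟨ht.1.le, ht.2.le.trans hb.2⟩
      rw [← ENNReal.ofReal_add (mul_nonneg (hā0 t) (hY0 t)) (mul_nonneg hC₄ (hF0 t))]
      exact ENNReal.ofReal_le_ofReal (hslice t htS)
    have hmeas : AEMeasurable (fun t => ENNReal.ofReal (ā t * Y t)) (volume.restrict (Ioo 0 b)) :=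
      (ENNReal.continuous_ofReal.comp_continuousOn
        (hāY_cont.mono (Ioo_subset_Icc_self.trans (Icc_subset_Icc_right hb.2)))).aemeasurable
        measurableSet_Ioo
    calc φ b = ENNReal.ofReal (Y 0 + ∫ t in Ioo 0 b, Φ t) := by
          show ENNReal.ofReal (Y b) = _
          rw [hYb]
      _ ≤ ENNReal.ofReal (Y 0) + ENNReal.ofReal (∫ t in Ioo 0 b, Φ t) := ENNReal.ofReal_add_le
      _ ≤ ENNReal.ofReal (Y 0) + ∫⁻ t in Ioo 0 b, ENNReal.ofReal (Φ t) :=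
          add_le_add le_rfl (ofReal_integral_le_lintegral_ofReal' _)
      _ ≤ ENNReal.ofReal (Y 0) + ∫⁻ t in Ioo 0 b,
            (ENNReal.ofReal (ā t * Y t) + ENNReal.ofReal (C₄ * F t)) :=
          add_le_add le_rfl (setLIntegral_mono' measurableSet_Ioo hpt)
      _ = ENNReal.ofReal (Y 0) + ((∫⁻ t in Ioo 0 b, ENNReal.ofReal (ā t * Y t)) +
            ∫⁻ t in Ioo 0 b, ENNReal.ofReal (C₄ * F t)) := by rw [lintegral_add_left' hmeas]
      _ ≤ ENNReal.ofReal (Y 0) + ((∫⁻ t in Ioo 0 b, a t * φ t) + ENNReal.ofReal (C₄ * I)) := by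
          gcongr with t
          · rw [hadef, hφdef, ← ENNReal.ofReal_mul (hā0 t)]
          · calc ∫⁻ t in Ioo 0 b, ENNReal.ofReal (C₄ * F t)
                ≤ ∫⁻ t in Ioo 0 T'', ENNReal.ofReal (C₄ * F t) :=
                  lintegral_mono_set (Ioo_subset_Ioo le_rfl hb.2)
              _ = ENNReal.ofReal C₄ * ∫⁻ t in Ioo 0 T'', ENNReal.ofReal (F t) := by
                  rw [← lintegral_const_mul' _ _ ENNReal.ofReal_ne_top]
                  exact lintegral_congr fun t => ENNReal.ofReal_mul hC₄
              _ ≤ ENNReal.ofReal C₄ * ENNReal.ofReal I := mul_le_mul' le_rfl hIF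
              _ = ENNReal.ofReal (C₄ * I) := (ENNReal.ofReal_mul hC₄).symm
      _ = Bg + ∫⁻ s in Ioo 0 b, a s * φ s := by
          rw [hBg, ENNReal.ofReal_add (hY0 0) (by positivity)]
          ring
  -- hypotheses of Grönwall
  have hBgtop : Bg ≠ ⊤ := ENNReal.ofReal_ne_top
  have hφM : ∀ t ∈ Icc 0 T'', φ t ≤ V₀ := fun t ht => hYV t ht
  have haconst : ∀ t ∈ Icc 0 T'', a t ≤ ENNReal.ofReal (C₁ + C₂ * V₀.toReal + C₃ * Ē) := by
    intro t ht
    rw [hadef]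
    refine ENNReal.ofReal_le_ofReal ?_
    show C₁ + C₂ * Y t + C₃ * Ē ≤ C₁ + C₂ * V₀.toReal + C₃ * Ē
    have : Y t ≤ V₀.toReal := by
      have h := hYV t ht
      exact (ENNReal.ofReal_le_iff_le_toReal hV₀top.ne).1 h
    nlinarith
  have hatop : ∫⁻ t in Ioo 0 T'', a t ≠ ⊤ := by
    refine ne_top_of_le_ne_top ?_ (setLIntegral_mono' measurableSet_Ioo fun t ht =>
      haconst t ⟨ht.1.le, ht.2.le⟩)
    rw [setLIntegral_const]
    exact ENNReal.mul_ne_top ENNReal.ofReal_ne_top (measure_Ioo_lt_top.ne)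
  have hgron := lintegral_gronwall_le hBgtop hV₀top.ne hφM hatop hineq
  -- the exponent
  have hexp : ∀ t ∈ Icc 0 T'', (∫⁻ s in Ioo 0 t, a s).toReal ≤
      (C₁ + C₃ * Ē) * T'' + C₂ * (κ ^ 2 * I) := by
    intro t ht
    have hsplit : ∀ s ∈ Ioo 0 T'', a s ≤ ENNReal.ofReal (C₁ + C₃ * Ē) + ENNReal.ofReal (C₂ * κ ^ 2) *
        ENNReal.ofReal (F s) := by
      intro s hs
      have hsS : s ∈ Icc 0 T'' := ⟨hs.1.le, hs.2.le⟩
      have hκ0 : 0 ≤ C₂ * κ ^ 2 := mul_nonneg hC₂ (sq_nonneg _)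
      have hc13 : 0 ≤ C₁ + C₃ * Ē := by positivity
      rw [hadef, ← ENNReal.ofReal_mul hκ0, ← ENNReal.ofReal_add hc13 (mul_nonneg hκ0 (hF0 s))]
      refine ENNReal.ofReal_le_ofReal ?_
      show C₁ + C₂ * Y s + C₃ * Ē ≤ C₁ + C₃ * Ē + C₂ * κ ^ 2 * F s
      nlinarith [hYle s hsS, hC₂]
    have h1 : ∫⁻ s in Ioo 0 t, a s ≤ ∫⁻ s in Ioo 0 T'', a s := lintegral_mono_set (Ioo_subset_Ioo le_rfl ht.2)
    have h2 : ∫⁻ s in Ioo 0 T'', a s ≤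
        ENNReal.ofReal (C₁ + C₃ * Ē) * volume (Ioo (0 : ℝ) T'') + ENNReal.ofReal (C₂ * κ ^ 2) * ENNReal.ofReal I := by
      calc ∫⁻ s in Ioo 0 T'', a s ≤ ∫⁻ s in Ioo 0 T'', (ENNReal.ofReal (C₁ + C₃ * Ē) +
            ENNReal.ofReal (C₂ * κ ^ 2) * ENNReal.ofReal (F s)) := setLIntegral_mono' measurableSet_Ioo hsplit
        _ = ENNReal.ofReal (C₁ + C₃ * Ē) * volume (Ioo (0 : ℝ) T'') +
            ENNReal.ofReal (C₂ * κ ^ 2) * ∫⁻ s in Ioo 0 T'', ENNReal.ofReal (F s) := by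
            rw [lintegral_add_left measurable_const, setLIntegral_const,
              lintegral_const_mul' _ _ ENNReal.ofReal_ne_top]
        _ ≤ _ := add_le_add le_rfl (mul_le_mul' le_rfl hIF)
    have h3 : (ENNReal.ofReal (C₁ + C₃ * Ē) * volume (Ioo (0 : ℝ) T'') +
        ENNReal.ofReal (C₂ * κ ^ 2) * ENNReal.ofReal I) = ENNReal.ofReal ((C₁ + C₃ * Ē) * T'' + C₂ * (κ ^ 2 * I)) := by
      rw [Real.volume_Ioo, sub_zero, ← ENNReal.ofReal_mul (by positivity), ← ENNReal.ofReal_mul (by positivity),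
        ← ENNReal.ofReal_add (by positivity) (by positivity)]
      ring_nf
    have h4 := (h1.trans h2).trans_eq h3
    have := ENNReal.toReal_mono ENNReal.ofReal_ne_top h4
    rwa [ENNReal.toReal_ofReal (by positivity)] at this
  -- conclusion
  intro t ht
  have hg := hgron t ht
  have hfinal : φ t ≤ ENNReal.ofReal (((∫ x, ‖curl (u 0) x‖ ^ 2) + C₄ * I) *
      Real.exp ((C₁ + C₃ * Ē) * T'' + C₂ * (κ ^ 2 * I))) := by
    refine hg.trans ?_
    rw [hBg, ← ENNReal.ofReal_mul (by positivity)]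
    refine ENNReal.ofReal_le_ofReal (mul_le_mul_of_nonneg_left ?_ (by positivity))
    exact Real.exp_le_exp.2 (hexp t ht)
  have := (ENNReal.ofReal_le_ofReal_iff (by positivity)).1 hfinal
  exact this

end Literature.Analysis.FluidPDE

end
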